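import Literature.NumberTheory.NumberFields.ClassGroupMinusPartOddCharacters
import Literature.NumberTheory.NumberFields.CMFieldRelativeClassNumberDivisibility
import HarnessLib

/-!
# `p`-torsion classes descend along a Galois group of order prime to `p`:
# `#Cl(K^H)[p] = #Cl(K)[p]^H` (Neukirch III (1.6) (ii) + (iv); Washington §10.1)

Topic `NumberTheory/NumberFields` (namespace = path).  THEOREM-ONLY file (no definition, no named fact, no `sorry`),
written by the prover seat `bsd-potss-k8t-c4` g25 (cell `bsd-potss`; `--supports` stmt-BirchSwinnertonDyer-19982, the
U₀ node `TameUpperDefectRankZero` of route K8-t′ `KatoDescentTamePotSupersingular`; closes nothing; BSD is proved for no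
curve here).

For a finite Galois extension `K/F` of number fields, a subgroup `H ≤ Gal(K/F)` and a prime `p ∤ #H`, the `p`-torsion of
the class group of the fixed field `K^H` is in bijection with the `H`-fixed ("ambiguous") `p`-torsion of `Cl(K)`:

* `mulEquiv_intAut_classGroupExtend_fixedField` — extended classes `i_{K/K^H}(d)` are fixed by every `h ∈ H`
  (`h(𝔞𝓞_K) = (h|_{K^H} 𝔞)𝓞_K = 𝔞𝓞_K`, tree `classGroupExtend_mulEquiv_intAut`);
* `natCard_torsion_classGroup_fixedField_le` — **`#Cl(K^H)[p] ≤ #Cl(K)[p]^H`**: `i_{K/K^H}` is injective on the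
  `p`-power torsion because `N ∘ i = (·)^{[K:K^H]} = (·)^{#H}` (Neukirch III (1.6) (ii), tree
  `classGroupExtend_injOn_pow_eq_one`) and `gcd(#H, p) = 1`;
* **`natCard_fixed_torsion_classGroup_eq_natCard_torsion_classGroup_fixedField`** — `#Cl(K)[p]^H = #Cl(K^H)[p]`, the
  previous inequality combined with the converse one of the tree (`natCard_fixed_torsion_classGroup_le`, seat rkm g37:
  `i ∘ N = ∏_{h ∈ H} h = (·)^{#H}` on `H`-fixed classes, Neukirch III (1.6) (iv)).

So `rank_p Cl(K^H) = dim_{𝔽_p} Cl(K)[p]^H` whenever `p ∤ #H` (with `#Cl[p] = p^{rank_p}`, tree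
`IwasawaTheory.natCard_torsion_classGroup_layer_eq` for the layers of a `ℤ_p`-tower).  This is the `p ∤ #H` case of the
descent of ideal classes (Washington §10.1: for `p ∤ [K : K^H]` the map `Cl(K^H)[p^∞] → Cl(K)[p^∞]^{Gal}` is an
isomorphism); the cell uses it to read the `p`-rank of a non-Galois leaf `ℚ(P) = L^H` of a division field `L = ℚ(E[p])`
on the `Gal(L/ℚ)`-module `Cl(L)[p]` (isotypic bookkeeping of the μ-roads of the K8-t′ / K9 census).

## References

* J. Neukirch, *Algebraic Number Theory*, Grundlehren 322 (1999), Ch. III §1 Prop. (1.6) (ii), (iv). [NeukirchANT1999]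
* L. C. Washington, *Introduction to Cyclotomic Fields*, 2nd ed., GTM 83 (1997), §10.1 (before Thm. 10.1). [Washington1997]
-/

noncomputable section

open NumberField IntermediateField

namespace Literature.NumberTheory.NumberFields

variable (F K : Type) [Field F] [NumberField F] [Field K] [NumberField K] [Algebra F K]

/-- **Extended classes from a fixed field are ambiguous**: for `h ∈ H ≤ Gal(K/F)` and a class `d` of `K^H`,
`h • i_{K/K^H}(d) = i_{K/K^H}(d)` — since `h` restricts to the identity of `K^H`
(`i_{K/K^H}(σ|_{K^H} • d) = σ • i_{K/K^H}(d)`, tree `classGroupExtend_mulEquiv_intAut`).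
[cite: NeukirchANT1999, Ch. III §1 Prop. (1.6) (iv)] -/
theorem mulEquiv_intAut_classGroupExtend_fixedField (H : Subgroup (K ≃ₐ[F] K)) (h : K ≃ₐ[F] K) (hh : h ∈ H)
    (d : ClassGroup (𝓞 ↥(fixedField H))) :
    ClassGroup.mulEquiv (AmbiguousClass.intAut h) (classGroupExtend ↥(fixedField H) K d) =
      classGroupExtend ↥(fixedField H) K d := by
  have hσ : ∀ x : ↥(fixedField H), h (algebraMap ↥(fixedField H) K x) =
      algebraMap ↥(fixedField H) K ((1 : ↥(fixedField H) ≃ₐ[F] ↥(fixedField H)) x) := by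
    intro x
    rw [AlgEquiv.one_apply]
    exact (mem_fixedField_iff H (x : K)).mp x.2 h hh
  have key := classGroupExtend_mulEquiv_intAut ↥(fixedField H) K h
    (1 : ↥(fixedField H) ≃ₐ[F] ↥(fixedField H)) hσ d
  rw [AmbiguousClass.mulEquiv_intAut_one, MulEquiv.refl_apply] at key
  exact key.symm

/-- **`#Cl(K^H)[p] ≤ #Cl(K)[p]^H` for `p ∤ #H`**: the extension map `i_{K/K^H} : Cl(K^H) → Cl(K)` sends `p`-torsion
classes to `H`-fixed `p`-torsion classes (`mulEquiv_intAut_classGroupExtend_fixedField`) and is injective on the `p`-power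
torsion, because `N_{K/K^H} ∘ i_{K/K^H} = (·)^{[K : K^H]}` with `[K : K^H] = #H` prime to `p`
(tree `classGroupExtend_injOn_pow_eq_one`). [cite: NeukirchANT1999, Ch. III §1 Prop. (1.6) (ii)]
[cite: Washington1997, §10.1] -/
theorem natCard_torsion_classGroup_fixedField_le (H : Subgroup (K ≃ₐ[F] K)) [Fintype H] {p : ℕ} (hp : p.Prime)
    (hpH : ¬ p ∣ Fintype.card H) :
    Nat.card {d : ClassGroup (𝓞 ↥(fixedField H)) // d ^ p = 1} ≤
      Nat.card {c : ClassGroup (𝓞 K) // c ^ p = 1 ∧ ∀ h ∈ H, ClassGroup.mulEquiv (AmbiguousClass.intAut h) c = c} := by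
  classical
  haveI : FiniteDimensional F K := Module.Finite.of_restrictScalars_finite ℚ F K
  have hdeg : Module.finrank ↥(fixedField H) K = Fintype.card H := by
    rw [finrank_fixedField_eq_card, Nat.card_eq_fintype_card]
  have hpn : ¬ p ∣ Module.finrank ↥(fixedField H) K := by rw [hdeg]; exact hpH
  let Φ : {d : ClassGroup (𝓞 ↥(fixedField H)) // d ^ p = 1} →
      {c : ClassGroup (𝓞 K) // c ^ p = 1 ∧ ∀ h ∈ H, ClassGroup.mulEquiv (AmbiguousClass.intAut h) c = c} := fun d =>
    ⟨classGroupExtend ↥(fixedField H) K d.1, by rw [← map_pow, d.2, map_one],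
      fun h hh => mulEquiv_intAut_classGroupExtend_fixedField F K H h hh d.1⟩
  have hΦ : Function.Injective Φ := by
    rintro ⟨d, hd⟩ ⟨d', hd'⟩ hdd
    apply Subtype.ext
    have h1 : classGroupExtend ↥(fixedField H) K d = classGroupExtend ↥(fixedField H) K d' :=
      congrArg Subtype.val hdd
    exact classGroupExtend_injOn_pow_eq_one ↥(fixedField H) K hp hpn ⟨1, by rw [pow_one]; exact hd⟩
      ⟨1, by rw [pow_one]; exact hd'⟩ h1
  exact Nat.card_le_card_of_injective Φ hΦ

/-- **`#Cl(K)[p]^H = #Cl(K^H)[p]` for `p ∤ #H`** (`K/F` finite Galois, `H ≤ Gal(K/F)`): the `H`-fixed `p`-torsion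
classes of `K` are exactly as many as the `p`-torsion classes of the fixed field `K^H` — `≤` is the tree's
`natCard_fixed_torsion_classGroup_le` (the norm is injective on `H`-fixed `p`-torsion classes, `i ∘ N = (·)^{#H}`, Neukirch
III (1.6) (iv)), `≥` is `natCard_torsion_classGroup_fixedField_le` (the extension map is injective on `p`-torsion,
`N ∘ i = (·)^{#H}`, (1.6) (ii)).  Equivalently `rank_p Cl(K^H) = dim_{𝔽_p} Cl(K)[p]^H`.
[cite: NeukirchANT1999, Ch. III §1 Prop. (1.6) (ii), (iv)] [cite: Washington1997, §10.1] -/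
theorem natCard_fixed_torsion_classGroup_eq_natCard_torsion_classGroup_fixedField [IsGalois F K]
    (H : Subgroup (K ≃ₐ[F] K)) [Fintype H] {p : ℕ} (hp : p.Prime) (hpH : ¬ p ∣ Fintype.card H) :
    Nat.card {c : ClassGroup (𝓞 K) // c ^ p = 1 ∧ ∀ h ∈ H, ClassGroup.mulEquiv (AmbiguousClass.intAut h) c = c} =
      Nat.card {d : ClassGroup (𝓞 ↥(fixedField H)) // d ^ p = 1} :=
  le_antisymm (natCard_fixed_torsion_classGroup_le F K H hp hpH) (natCard_torsion_classGroup_fixedField_le F K H hp hpH)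

end Literature.NumberTheory.NumberFields

end
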